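import Mathlib.MeasureTheory.Integral.IntervalIntegral.Basic
import Mathlib.MeasureTheory.Function.LocallyIntegrable
import Mathlib.Analysis.Asymptotics.Defs
import Mathlib.Analysis.Calculus.Deriv.Basic
import Mathlib.Analysis.SpecialFunctions.Complex.Circle
import Mathlib.LinearAlgebra.Matrix.Determinant.Basic
import Mathlib.Topology.Algebra.InfiniteSum.Real
import Mathlib.Data.Set.Card
import Literature.Geometry.Lorentzian.Sweep2
import Literature.Geometry.Lorentzian.KerrStarChartBounds
import Literature.Geometry.Lorentzian.KerrTimelikeSpan
import Literature.Geometry.Lorentzian.CoordCurvature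
import Literature.Geometry.Lorentzian.Geodesic
import HarnessLib

/-!
# Bound Kerr geodesics, the point-mass Teukolsky perturbation, and its orbit-averaged fluxes

Definition file (notion `KerrGeodesicTeukolskyFluxes`, topic `Literature/Geometry/Lorentzian`),
requested to give the route item *NoFloating* (final state conjecture, "no floating orbits":
`⟨Ė^∞ + Ė^H⟩ > 0` for every bound non-plunging timelike geodesic of sub-extremal Kerr) a
signature. On the ingoing Kerr–Schild Cartesian chart `Kerr.exterior M a = {r > r₊} ⊆ E4` of
`KerrSchild.lean` (index `0 = t*`) we define:

1. **Bound timelike geodesics** `Kerr.BoundGeodesic M a` (a structure: a unit-speed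
   future-directed timelike geodesic of `g_{M,a}` whose Kerr–Schild radius stays in a compact
   shell `r₊ < r₁ ≤ r ≤ r₂`), their constants of motion `E`, `L_z`, `Q` (energy and axial
   angular momentum from the Killing fields `∂_{t*}`, `∂_φ̃`; Carter constant from the
   Walker–Penrose Killing tensor `K = 2Σ l ⊙ n + r² g` in the Kinnersley frame), the first-order
   potentials `R(r)`, `Θ`, `T_r + T_θ = dt/dλ`, `Φ_r + Φ_θ = dφ/dλ` of the Mino-time formulation,
   the Mino-time frequencies `Υ_r, Υ_θ, Υ_φ`, `Γ`, the coordinate-time fundamental frequencies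
   `Ω_r, Ω_θ, Ω_φ = Υ/Γ` and the discrete spectrum `ω_{mkn} = mΩ_φ + kΩ_θ + nΩ_r`
   (Hughes–Warburton–Khanna–Chua–Katz, PRD 103 (2021) 104014 = arXiv:2102.02713, §II,
   (2.1)–(2.14); Drasco–Hughes, PRD 73 (2006) 024027 = arXiv:gr-qc/0509101, §2 and App. A;
   Schmidt 2002; Fujita–Hikida 2009).
2. **Linearised curvature in a chart, by differentiation of the exact objects**: for components
   `G` of a metric and a perturbation `H` (both `E → (E →L E →L ℝ)`), the linearised Einstein
   tensor `MetricCoord.linEinsteinAt G H x = d/dε|₀ Ein(G + εH)(x)` and the linearised Riemann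
   tensor `MetricCoord.linRiemannAt`, built on the coordinate curvature calculus of
   `CoordCurvature.lean` (`MetricCoord.riemAt`, `ricAt`, `scalAt`); no Newman–Penrose formula is
   transcribed.
3. **The retarded first-order perturbation of Kerr by a unit point mass on `γ`** as a hypothesis
   structure `Kerr.PointMassPerturbation M a γ` (house pattern of `BondiFoliation` /
   `StationaryAFBlackHole`): a symmetric `h` on the chart, smooth off the world-line, locally
   integrable, solving the linearised Einstein equations with the point-mass stress tensor
   `T^{ab} = ∫ u^a u^b δ⁴(x − γ(τ)) (−g)^{-1/2} dτ` in the WEAK sense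
   (`∫ ⟨h, δG[φ]⟩_g dvol_g = 8π ∫ φ(γ̇, γ̇) dτ` for all smooth compactly supported symmetric test
   fields `φ` in the exterior — `δG` is formally self-adjoint at a vacuum metric), whose Weyl
   scalar `ψ₄ = −δC_{αβγδ} n^α m̄^β n^γ m̄^δ` (Kinnersley tetrad; Teukolsky 1973) has Bohr–Fourier
   modes in Boyer–Lindquist time obeying the RETARDED radiation conditions mode by mode: purely
   outgoing at `𝓘⁺` (`R_{ℓmω} ∼ Z^∞ r³ e^{iωr*}`, no `r^{-1}e^{-iωr*}` admixture — imposed through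
   a five-term asymptotic expansion, since for `s = −2` the incoming solution is subdominant by
   `r^{-4}`) and purely ingoing at `𝓗⁺` (`R_{ℓmω} ∼ Z^H Δ² e^{-i(ω − mΩ_H) r*}`); HWKCK 2021,
   (3.1)–(3.9); Drasco–Hughes 2006, (3.9)–(3.18); Teukolsky–Press 1974.
4. **Defined from 3**: the master field `Ψ = (r − ia cos θ)⁴ ψ₄`, its `(ω, m)` Bohr–azimuthal
   modes, the spin-weight `−2` spheroidal eigen-data `(S_{ℓm}^{aω}, 𝓔_{ℓm})` (Hughes 2000,
   App. A (A.1); normalisation `∫ S² sin θ dθ = 1/2π`, Drasco–Hughes (3.8)), the asymptotic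
   amplitudes `Z^∞_{ℓm}(ω)`, `Z^H_{ℓm}(ω)` (HWKCK (3.5)–(3.6)), the Teukolsky–Press horizon factor
   `α_{ℓmω}` with the Starobinsky constant `|C_{ℓmω}|²` (HWKCK (3.30)–(3.32); Teukolsky–Press
   1974, §IV–V), and the **orbit-averaged energy fluxes**
   `⟨Ė^∞⟩ = Σ |Z^∞_{ℓm}(ω)|²/(4πω²)`, `⟨Ė^H⟩ = Σ α_{ℓmω} |Z^H_{ℓm}(ω)|²/(4πω²)` (HWKCK (3.26)),
   `netFlux = ⟨Ė^∞⟩ + ⟨Ė^H⟩`.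

## What is and is not encoded (read before using `PointMassPerturbation`)

* The fluxes are sums over `(ℓ, m)` and over the SET of frequencies `ω ∈ ℝ` (a `tsum` over `ℝ`
  of a family supported on the countable Bohr spectrum). For a non-resonant orbit
  (`Ω_θ/Ω_r ∉ ℚ`, so that `(k, n) ↦ ω_{mkn}` is injective) this IS the printed sum over
  `(ℓ, m, k, n)` with `Z_{ℓm}(ω_{mkn}) = Z_{ℓmkn}`; on a resonant orbit the printed `(k, n)`-sum is
  not the flux of that orbit (the amplitudes of coincident frequencies add before squaring;
  Flanagan–Hinderer 2012, HWKCK 2021 footnote 4), whereas the present definition always is.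
* `PointMassPerturbation` records what the cited works USE about the retarded field (weak field
  equation with the correct source and normalisation `μ = 1`, smoothness off the world-line,
  existence of the Bohr means and asymptotic amplitudes, retarded boundary behaviour). It does
  NOT assert existence (a theorem about the retarded Green's function of linearised gravity on
  Kerr) nor uniqueness of the resulting amplitudes: two inhabitants differ by a weak vacuum
  perturbation whose `ψ₄`-modes obey both radiation conditions, i.e. by real-frequency MODE
  solutions, which vanish by mode stability on the real axis (Whiting 1989; Andersson–Ma–
  Paganini–Whiting 2017; Teixeira da Costa 2020) — a theorem, deliberately not built in. A
  statement `∀ 𝔭 : PointMassPerturbation M a γ, 0 < 𝔭.netFlux` is therefore the intended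
  reading of "no floating" and is neither vacuous nor trivially false for that reason alone.
* Gauge: `h` is any representative (the Lorenz-gauge retarded field qualifies); `ψ₄` is gauge-
  and tetrad-invariant to first order on the type-D background (Teukolsky 1973, §II), so all
  defined quantities depend on `h` only through its gauge class.
* Conventions: signature `(−+++)`, `G_{ab} = 8π T_{ab}`, curvature `R(X,Y) = [∇_X,∇_Y] − ∇_{[X,Y]}`
  and `Ric(Y,Z) = tr (X ↦ R(X,Y)Z)` (those of `CoordCurvature.lean`, = MTW); Boyer–Lindquist
  `t = t* − (r*(r) − r)`, `φ = φ̃ − φ̄(r)` on the chart (`Kerr.starAngle`; `KerrStarCoord.lean`: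
  `x + iy = (r + ia) e^{iφ̃} sin θ`), both up to additive constants (choice of origin), which only
  multiply every `Z_{ℓm}(ω)` by a unit phase; likewise the additive constant in `r*`
  (`Kerr.tortoise`, HWKCK (3.7)). The spheroidal harmonic `S_{ℓm}^{aω}` is fixed up to sign
  (`Classical.epsilon`); `|Z|²`, hence every flux, is insensitive to all these choices.
* Junk values: `limUnder` / `tsum` / interval integrals return junk (`0` or an arbitrary limit)
  when the limit / sum / integral does not exist; the honest hypotheses are the fields of
  `PointMassPerturbation`. Degenerate orbits: for circular (`r_min = r_max`) resp. equatorial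
  (`z_max = 0`) orbits the radial resp. polar averages are the point values and `Υ_r` resp. `Υ_θ`
  is the junk value `0`; the fluxes never use the frequencies.
* `Kerr.Facts` / `HasLeviCivita`: only `BoundGeodesic` (through `Kerr.metric` and its
  Levi-Civita connection) carries the standing instance hypotheses of the prelude; everything
  built from the components `Kerr.bilin` does not.

## References

* S. A. Teukolsky, ApJ 185 (1973) 635 (master equation (4.7), Kinnersley tetrad (4.4),
  separation (4.9)–(4.10)); S. A. Teukolsky, W. H. Press, ApJ 193 (1974) 443, §IV–V (horizon
  flux, (4.44), Starobinsky constant). [both paywalled here; restated in the following]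
* S. A. Hughes, PRD 61 (2000) 084004 = arXiv:gr-qc/9910091, §IV (4.1)–(4.7), App. A (A.1).
* S. Drasco, S. A. Hughes, PRD 73 (2006) 024027 = arXiv:gr-qc/0509101, §2–3, App. A–B
  (key `DrascoHughes2006`).
* S. A. Hughes, N. Warburton, G. Khanna, A. J. K. Chua, M. L. Katz, PRD 103 (2021) 104014 =
  arXiv:2102.02713, §II (2.1)–(2.14), §III (3.1)–(3.9), (3.21), (3.26), (3.30)–(3.32)
  (key `HughesEtAl2021`).
* B. Carter, Phys. Rev. 174 (1968) 1559; M. Walker, R. Penrose, Commun. Math. Phys. 18 (1970)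
  265 (Killing tensor); W. Schmidt, CQG 19 (2002) 2743; R. Fujita, W. Hikida, CQG 26 (2009)
  135002 (Mino-time frequencies).
* C. W. Misner, K. S. Thorne, J. A. Wheeler, *Gravitation* (1973), §35.13–35.15 (Isaacson
  flux), (33.32) (Kerr geodesics).
-/

noncomputable section

open Set Filter MeasureTheory TopologicalSpace Complex Asymptotics
open scoped Topology Manifold ContDiff Real

namespace Literature.Geometry.Lorentzian

/-! ## Part 1. Linearised curvature of metric components, by differentiation -/

namespace MetricCoord

variable {E : Type*} [NormedAddCommGroup E] [NormedSpace ℝ E]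

/-- The metric pairing of two bilinear forms at `x`:
`⟨h, k⟩_G = g^{ac} g^{bd} h_{ab} k_{cd} = tr ((♯ ∘ h) ∘ (♯ ∘ kᵗ))` (polarisation of
`MetricCoord.normSqAt`; for symmetric `h`, `k` the order of slots is immaterial).
O'Neill 1983, Ch. 3, pp. 60–61 (metric contraction of tensors). [cite: ONeill1983, Ch. 3, pp. 60–61] -/
def innerAt (G : E → E →L[ℝ] E →L[ℝ] ℝ) (x : E) (h k : E →L[ℝ] E →L[ℝ] ℝ) : ℝ :=
  LinearMap.trace ℝ E
    ((((sharpAt G x).comp h).comp ((sharpAt G x).comp k.flip) : E →L[ℝ] E) : E →ₗ[ℝ] E)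

/-- `⟨h, h⟩_G = |h|²_G` (`MetricCoord.normSqAt`). [folklore] -/
theorem innerAt_self (G : E → E →L[ℝ] E →L[ℝ] ℝ) (x : E) (h : E →L[ℝ] E →L[ℝ] ℝ) :
    innerAt G x h h = normSqAt G x h := rfl

variable [FiniteDimensional ℝ E]

/-- The **Einstein tensor of the components** at `x`: `Ein = Ric − (S/2) G`
(`MetricCoord.ricAt`, `MetricCoord.scalAt`; O'Neill 1983, Ch. 12, Def. 12.3 / Ch. 3, Def. 3.53;
MTW (8.49)). [cite: ONeill1983, Ch. 12, Def. 12.3] -/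
def einsteinAt (G : E → E →L[ℝ] E →L[ℝ] ℝ) (x : E) : E →L[ℝ] E →L[ℝ] ℝ :=
  ricAt G x - (scalAt G x / 2) • G x

/-- The **linearised Einstein operator** of the components `G` applied to a perturbation `H`,
at `x`: `δG[H](x) = d/dε|_{ε=0} Ein(G + εH)(x)` (one-variable `deriv` of the exact Einstein
tensor of the perturbed components; junk `0` where not differentiable). This is the operator of
the linearised Einstein equations `δG[h] = 8π T` about `G` (MTW §35.13, (35.58)–(35.59); Wald
1984, (7.5.15) for its Ricci part); defining it by differentiation avoids transcribing the
second-order formula. [cite: HughesEtAl2021, §III.A] -/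
def linEinsteinAt (G H : E → E →L[ℝ] E →L[ℝ] ℝ) (x : E) : E →L[ℝ] E →L[ℝ] ℝ :=
  deriv (fun ε : ℝ ↦ einsteinAt (fun y ↦ G y + ε • H y) x) 0

/-- The **linearised Riemann tensor (all indices lowered)** of `G` in the direction `H` at `x`:
`δ[g(R(X,Y)Z, W)] = d/dε|_{ε=0} (G + εH)_x (R_{G+εH}(X,Y)Z, W)` (both the curvature
endomorphism `MetricCoord.riemAt` and the lowering metric are perturbed). With the component
convention `R_{αβγδ} = g(R(e_γ,e_δ)e_β, e_α)` of O'Neill 1983, Ch. 3, Lemma 3.38 / MTW, the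
contraction `R_{αβγδ} W^α Z^β X^γ Y^δ` is `linRiemannAt G H x X Y Z W`. [cite: ONeill1983, Ch. 3, Lemma 3.38] -/
def linRiemannAt (G H : E → E →L[ℝ] E →L[ℝ] ℝ) (x : E) (X Y Z W : E) : ℝ :=
  deriv (fun ε : ℝ ↦ (G x + ε • H x) (riemAt (fun y ↦ G y + ε • H y) x X Y Z) W) 0

end MetricCoord

/-! ## Part 2. Boyer–Lindquist dictionary on the Kerr–Schild chart (continued from `Sweep2`) -/

namespace Kerr

/-- `Σ = r² + a² cos² θ` (Boyer–Lindquist `Σ`, Teukolsky's `ρρ̄⁻¹…`; `ρ² ` in DHR) as a function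
on the Kerr–Schild chart (`r = Kerr.radius`, `cos θ = x₃/r = Kerr.cosTheta`). Drasco–Hughes
2006, (2.2); HWKCK 2021, §II.A. [cite: DrascoHughes2006, (2.2)] -/
def blSigmaE4 (a : ℝ) (x : E4) : ℝ := radius a x ^ 2 + a ^ 2 * cosTheta a x ^ 2

/-- The **tortoise coordinate** `r*(r) = r + (M r₊/√(M² − a²)) log(r/r₊ − 1)
− (M r₋/√(M² − a²)) log(r/r₋ − 1)`, `dr*/dr = (r² + a²)/Δ`, in the normalisation of
HWKCK 2021, (3.7) (it differs from `Kerr.starTime` by an additive constant). Junk for `|a| ≥ M`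
or `r ≤ r₊`. [cite: HughesEtAl2021, (3.7)] -/
def tortoise (M a r : ℝ) : ℝ :=
  r + M * rPlus M a / √(M ^ 2 - a ^ 2) * Real.log (r / rPlus M a - 1) -
    M * rMinus M a / √(M ^ 2 - a ^ 2) * Real.log (r / rMinus M a - 1)

/-- The **Boyer–Lindquist time** of a point of the ingoing Kerr–Schild chart:
`t = t* − (r*(r) − r)` (the chart time is `t* = v − r`, `v = t + r*` the advanced time;
`KerrStarCoord.lean`, `Kerr.starTime`: `dt*/dt = 1`, `∂t*/∂r|_{t} = (r²+a²)/Δ − 1 = 2Mr/Δ`).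
Defined up to the additive constant fixed by `Kerr.tortoise`. Drasco–Hughes 2006, §3.1;
Teukolsky 1973, §IV. [cite: DrascoHughes2006, §3.1] -/
def blTime (M a : ℝ) (x : E4) : ℝ := x 0 - (tortoise M a (radius a x) - radius a x)

/-- The Kinnersley vector **`l = ((r²+a²)/Δ) ∂_t + ∂_r + (a/Δ) ∂_φ`** (outgoing principal null
direction, `l · n = −1`) in Kerr–Schild Cartesian components, through the dictionary
`∂_t ↦ ∂_{t*}`, `∂_r ↦ Kerr.blRadialVector`, `∂_φ ↦ Kerr.blAxialVector` of `Sweep2.lean`.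
Singular on `Δ = 0` (not in the exterior). Teukolsky 1973, (4.4); Drasco–Hughes 2006, (A.3). [cite: DrascoHughes2006, (A.3)] -/
def kinnersleyL (M a : ℝ) (x : E4) : E4 :=
  ((radius a x ^ 2 + a ^ 2) / delta M a (radius a x)) • E4.basisVector 0 + blRadialVector M a x +
    (a / delta M a (radius a x)) • blAxialVector x

/-- The Kinnersley vector **`n = ((r²+a²) ∂_t − Δ ∂_r + a ∂_φ)/(2Σ)`** (ingoing principal null
direction) in Kerr–Schild Cartesian components. Teukolsky 1973, (4.4); Drasco–Hughes 2006,
(A.5). [cite: DrascoHughes2006, (A.5)] -/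
def kinnersleyN (M a : ℝ) (x : E4) : E4 :=
  (2 * blSigmaE4 a x)⁻¹ •
    ((radius a x ^ 2 + a ^ 2) • E4.basisVector 0 - delta M a (radius a x) • blRadialVector M a x +
      a • blAxialVector x)

/-- The Kinnersley vector **`m = (ia sin θ ∂_t + ∂_θ + (i/ sin θ) ∂_φ)/(√2 (r + ia cos θ))`** as a
complex `4`-vector of Kerr–Schild Cartesian components (`∂_θ + (i/sin θ)∂_φ̃ = Kerr.frameM`,
`Sweep2.lean`; junk-zero on the axis like `frameM`). Teukolsky 1973, (4.4); Drasco–Hughes 2006,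
(A.4) (which prints the prefactor `−ρ/√2`, `ρ = −1/(r − ia cos θ)`, i.e. `ρ` for `ρ̄`; the
Kinnersley–Teukolsky `m` has `1/(√2 (r + ia cos θ))`, consistent with `m̄ ∝ ρ` of Hughes 2000,
before (4.10)). [cite: DrascoHughes2006, (A.4)] -/
def kinnersleyM (a : ℝ) (x : E4) : Fin 4 → ℂ := fun μ ↦
  (frameM a x μ + if μ = 0 then I * (a * sinTheta a x : ℝ) else 0) /
    ((Real.sqrt 2 : ℂ) * ((radius a x : ℂ) + I * (a * cosTheta a x : ℝ)))

/-- The real part `Re m` of the Kinnersley vector `m`, as a vector of `E4`. [folklore] -/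
def kinnersleyReM (a : ℝ) (x : E4) : E4 := WithLp.toLp 2 fun μ ↦ (kinnersleyM a x μ).re

/-- The imaginary part `Im m` of the Kinnersley vector `m` (so `m̄ = Re m − i Im m`), as a vector
of `E4`. [folklore] -/
def kinnersleyImM (a : ℝ) (x : E4) : E4 := WithLp.toLp 2 fun μ ↦ (kinnersleyM a x μ).im

/-! ## Part 3. Bound timelike geodesics of Kerr and their frequencies -/

section Geodesics

variable [Facts] (M a : ℝ) [(metric M a (rPlus M a)).HasLeviCivita]

/-- A **bound (non-plunging, non-escaping) timelike geodesic** of the Kerr exterior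
`({r > r₊}, g_{M,a})`: an affinely parametrised geodesic `γ : ℝ → Kerr.exterior M a` of the
Levi-Civita connection of `Kerr.metric M a r₊`, of unit timelike speed `g(γ̇, γ̇) = −1` (proper
time; unit rest mass), future directed (`dt*/dτ > 0`, i.e. `g(V, γ̇) < 0` for the time
orientation `V = −g♯ dt*` of `Kerr.timeOrientation`), whose Kerr–Schild radius is confined for
all proper time to a shell `r₊ < r₁ ≤ r(γ(τ)) ≤ r₂ < ∞`. For `|a| < M` these are exactly the
orbits with `r` oscillating between turning points `r₊ < r_min ≤ r ≤ r_max` (or constant), the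
sources of the adiabatic EMRI fluxes. Drasco–Hughes 2006, §2 ("the orbit must be bounded by two
radii `r_min ≤ r ≤ r_max`"); HWKCK 2021, §II.A–B; MTW (33.32). [cite: DrascoHughes2006, §2] -/
structure BoundGeodesic where
  /-- The world-line, parametrised by proper time, in the Kerr–Schild exterior chart. -/
  curve : ℝ → exterior M a
  /-- `γ` is a geodesic of the Levi-Civita connection of `g_{M,a}` on all of `ℝ`. -/
  isGeodesic : IsGeodesic (metric M a (rPlus M a)).leviCivita curve
  /-- Unit timelike speed: the parameter is proper time. -/
  unit_speed : ∀ τ : ℝ, (metric M a (rPlus M a)).val (curve τ)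
    (velocity 𝓘(ℝ, E4) curve τ) (velocity 𝓘(ℝ, E4) curve τ) = -1
  /-- Future directed: `dt*/dτ > 0`. -/
  future : ∀ τ : ℝ, 0 < E4.time (velocity 𝓘(ℝ, E4) curve τ)
  /-- Bound and non-plunging: the radius stays in a compact shell of the open exterior. -/
  bound : ∃ r₁ r₂ : ℝ, rPlus M a < r₁ ∧
    ∀ τ : ℝ, r₁ ≤ radius a (curve τ : E4) ∧ radius a (curve τ : E4) ≤ r₂

variable {M a}

namespace BoundGeodesic

variable (γ : BoundGeodesic M a)

/-- The position `γ(τ) ∈ E4` on the chart. [folklore] -/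
def pos (τ : ℝ) : E4 := (γ.curve τ : E4)

/-- The four-velocity `u = γ̇(τ) ∈ E4` (Kerr–Schild components). [folklore] -/
def vel (τ : ℝ) : E4 := (velocity 𝓘(ℝ, E4) γ.curve τ : E4)

/-- The Kerr–Schild radius `r(τ)` along the orbit. [folklore] -/
def rad (τ : ℝ) : ℝ := radius a (γ.pos τ)

/-- The world-line as a subset of the chart. [folklore] -/
def worldLine : Set E4 := range γ.pos

/-- The orbit stays strictly outside the event horizon, uniformly: `r₊ < r₁ ≤ r(τ)`.
Drasco–Hughes 2006, §2. [cite: DrascoHughes2006, §2] -/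
theorem rPlus_lt_rad (τ : ℝ) : rPlus M a < γ.rad τ := by
  obtain ⟨r₁, r₂, h₁, h⟩ := γ.bound
  exact h₁.trans_le (h τ).1

/-- The radius along a bound orbit is positive. [folklore] -/
theorem rad_pos (τ : ℝ) : 0 < γ.rad τ := by
  have h : max (rPlus M a) 0 < γ.rad τ := γ.curve τ |>.2
  exact (le_max_right _ _).trans_lt h

/-- The radius along a bound orbit is bounded below. [folklore] -/
theorem bddBelow_rad : BddBelow (range γ.rad) := by
  obtain ⟨r₁, r₂, -, h⟩ := γ.bound
  exact ⟨r₁, by rintro _ ⟨τ, rfl⟩; exact (h τ).1⟩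

/-- The radius along a bound orbit is bounded above. [folklore] -/
theorem bddAbove_rad : BddAbove (range γ.rad) := by
  obtain ⟨r₁, r₂, -, h⟩ := γ.bound
  exact ⟨r₂, by rintro _ ⟨τ, rfl⟩; exact (h τ).2⟩

/-- The inner turning radius `r_min = inf_τ r(τ)` (`= p/(1+e)`). Drasco–Hughes 2006, (2.6);
HWKCK 2021, (2.15). [cite: HughesEtAl2021, (2.15)] -/
def rMin : ℝ := ⨅ τ, γ.rad τ

/-- The outer turning radius `r_max = sup_τ r(τ)` (`= p/(1−e)`). Drasco–Hughes 2006, (2.6);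
HWKCK 2021, (2.15). [cite: HughesEtAl2021, (2.15)] -/
def rMax : ℝ := ⨆ τ, γ.rad τ

/-- `z_max = sup_τ |cos θ(τ)| = cos θ_min = sin I` (polar turning point; `Kerr.cosTheta = x₃/r`).
HWKCK 2021, (2.17). [cite: HughesEtAl2021, (2.17)] -/
def zMax : ℝ := ⨆ τ, |cosTheta a (γ.pos τ)|

/-- `r_min ≤ r(τ)`. [folklore] -/
theorem rMin_le_rad (τ : ℝ) : γ.rMin ≤ γ.rad τ := ciInf_le γ.bddBelow_rad τ

/-- `r(τ) ≤ r_max`. [folklore] -/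
theorem rad_le_rMax (τ : ℝ) : γ.rad τ ≤ γ.rMax := le_ciSup γ.bddAbove_rad τ

/-- `r₊ < r_min`: a bound orbit keeps a positive distance from the horizon.
Drasco–Hughes 2006, §2. [cite: DrascoHughes2006, §2] -/
theorem rPlus_lt_rMin : rPlus M a < γ.rMin := by
  obtain ⟨r₁, r₂, h₁, h⟩ := γ.bound
  exact h₁.trans_le (le_ciInf fun τ ↦ (h τ).1)

/-- `r_min ≤ r_max`. [folklore] -/
theorem rMin_le_rMax : γ.rMin ≤ γ.rMax := (γ.rMin_le_rad 0).trans (γ.rad_le_rMax 0)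

/-- The **energy** (per unit rest mass) `E = −g(∂_{t*}, u)` of the orbit, from the stationary
Killing field `∂_{t*}` (`= ∂_t` of Boyer–Lindquist; `Kerr.stationaryField`), read off at `τ = 0`
(it is constant along the geodesic by Killing's equation — not asserted here).
Drasco–Hughes 2006, (2.3); HWKCK 2021, §II.A. [cite: DrascoHughes2006, (2.3)] -/
def energy : ℝ := -Kerr.bilin M a (γ.pos 0) (E4.basisVector 0) (γ.vel 0)

/-- The **axial angular momentum** (per unit rest mass) `L_z = g(∂_φ, u)` from the axial Killing
field `∂_φ̃ = x₁∂₂ − x₂∂₁` (`Kerr.blAxialVector`), at `τ = 0`. Drasco–Hughes 2006, (2.3). [cite: DrascoHughes2006, (2.3)] -/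
def angularMomentum : ℝ := Kerr.bilin M a (γ.pos 0) (blAxialVector (γ.pos 0)) (γ.vel 0)

/-- The **Carter constant** (per unit rest mass squared) of the orbit, through the Walker–Penrose
Killing tensor `K_{ab} = 2Σ l_{(a} n_{b)} + r² g_{ab}` of Kerr in the Kinnersley frame
(`Kerr.kinnersleyL/N`): `Q = K(u,u) − (L_z − aE)² = 2Σ g(l,u) g(n,u) + r² g(u,u) − (L_z − aE)²`,
at `τ = 0`. For a unit-speed geodesic this is Carter's `Q = u_θ² + cos²θ (a²(1 − E²) + L_z²/sin²θ)`
(in Boyer–Lindquist components `2Σ (l·u)(n·u) = (P² − Σ² ṙ²)/Δ`, `P = E(r²+a²) − aL_z`, and the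
radial equation `Σ² ṙ² = R(r)` of `Kerr.radialPotential`), but unlike that expression it is
smooth across the axis. Carter 1968; Walker–Penrose 1970; Drasco–Hughes 2006, §2, (A.2)–(A.3). [cite: DrascoHughes2006, §2] -/
def carterConstant : ℝ :=
  2 * blSigmaE4 a (γ.pos 0) * Kerr.bilin M a (γ.pos 0) (kinnersleyL M a (γ.pos 0)) (γ.vel 0) *
      Kerr.bilin M a (γ.pos 0) (kinnersleyN M a (γ.pos 0)) (γ.vel 0) +
    γ.rad 0 ^ 2 * Kerr.bilin M a (γ.pos 0) (γ.vel 0) (γ.vel 0) -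
    (γ.angularMomentum - a * γ.energy) ^ 2

end BoundGeodesic

/-! ### The Mino-time potentials and the fundamental frequencies -/

/-- The radial potential `R(r) = [E(r²+a²) − aL_z]² − Δ [r² + (L_z − aE)² + Q]`,
`(dr/dλ)² = R(r)` in Mino time `λ` (`dτ = Σ dλ`), unit rest mass. HWKCK 2021, (2.1);
Drasco–Hughes 2006, (A.2). [cite: HughesEtAl2021, (2.1)] -/
def radialPotential (M a E L Q r : ℝ) : ℝ :=
  (E * (r ^ 2 + a ^ 2) - a * L) ^ 2 - delta M a r * (r ^ 2 + (L - a * E) ^ 2 + Q)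

/-- The polar potential as a function of `z = cos θ`:
`Θ(z) = Q − z² (a²(1 − E²) + L_z²/(1 − z²))` (`= Q − cot²θ L_z² − a² cos²θ (1 − E²)`),
`(dθ/dλ)² = Θ`, equivalently `(dz/dλ)² = (1 − z²) Θ(z)`. HWKCK 2021, (2.2); Drasco–Hughes
2006, (A.3). [cite: HughesEtAl2021, (2.2)] -/
def polarPotential (a E L Q z : ℝ) : ℝ :=
  Q - z ^ 2 * (a ^ 2 * (1 - E ^ 2) + L ^ 2 / (1 - z ^ 2))

/-- The radial part `T_r(r) = E (r²+a²)²/Δ − 2Mra L_z/Δ` of `dt/dλ = T_r(r) + T_θ(θ)`.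
HWKCK 2021, (2.4). [cite: HughesEtAl2021, (2.4)] -/
def minoTr (M a E L r : ℝ) : ℝ :=
  E * (r ^ 2 + a ^ 2) ^ 2 / delta M a r - 2 * M * r * a * L / delta M a r

/-- The polar part `T_θ = −a² E sin²θ = −a² E (1 − z²)` of `dt/dλ`. HWKCK 2021, (2.4). [cite: HughesEtAl2021, (2.4)] -/
def minoTθ (a E z : ℝ) : ℝ := -a ^ 2 * E * (1 - z ^ 2)

/-- The radial part `Φ_r(r) = 2MraE/Δ − a² L_z/Δ` of `dφ/dλ = Φ_r(r) + Φ_θ(θ)`. HWKCK 2021,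
(2.3). [cite: HughesEtAl2021, (2.3)] -/
def minoΦr (M a E L r : ℝ) : ℝ := (2 * M * r * a * E - a ^ 2 * L) / delta M a r

/-- The polar part `Φ_θ = L_z / sin²θ = L_z/(1 − z²)` of `dφ/dλ`. HWKCK 2021, (2.3). [cite: HughesEtAl2021, (2.3)] -/
def minoΦθ (L z : ℝ) : ℝ := L / (1 - z ^ 2)

namespace BoundGeodesic

variable (γ : BoundGeodesic M a)

/-- The Mino-time radial period `Λ_r = 2 ∫_{r_min}^{r_max} dr/√R(r)` (inverse-square-root
singularities at the simple turning points are integrable). HWKCK 2021, (2.5) and [31]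
(Fujita–Hikida 2009); Drasco–Hughes 2006, §2. Junk `0` for a circular orbit. [cite: HughesEtAl2021, (2.5)] -/
def minoRadialPeriod : ℝ :=
  2 * ∫ r in γ.rMin..γ.rMax,
    (√(radialPotential M a γ.energy γ.angularMomentum γ.carterConstant r))⁻¹

/-- The Mino-time polar period `Λ_θ = 4 ∫_0^{z_max} dz/√((1 − z²) Θ(z))`. HWKCK 2021, (2.5)
and [31]; Drasco–Hughes 2006, §2. Junk `0` for an equatorial orbit. [cite: HughesEtAl2021, (2.5)] -/
def minoPolarPeriod : ℝ :=
  4 * ∫ z in (0 : ℝ)..γ.zMax,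
    (√((1 - z ^ 2) * polarPotential a γ.energy γ.angularMomentum γ.carterConstant z))⁻¹

/-- The orbit average `⟨f_r⟩ = Λ_r⁻¹ ∮ f_r(r(λ)) dλ = (2/Λ_r) ∫_{r_min}^{r_max} f_r(r) dr/√R(r)` of
a function of `r` (HWKCK 2021, (2.12)); for a circular orbit (`r_min = r_max`) the point value.
[cite: HughesEtAl2021, (2.12)] -/
def radialAverage (f : ℝ → ℝ) : ℝ :=
  if γ.rMin = γ.rMax then f γ.rMin
  else (2 / γ.minoRadialPeriod) * ∫ r in γ.rMin..γ.rMax,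
    f r * (√(radialPotential M a γ.energy γ.angularMomentum γ.carterConstant r))⁻¹

/-- The orbit average `⟨f_θ⟩ = Λ_θ⁻¹ ∮ f_θ dλ = (4/Λ_θ) ∫_0^{z_max} f(z) dz/√((1−z²)Θ(z))` of an
even function of `z = cos θ` (HWKCK 2021, (2.13)); for an equatorial orbit (`z_max = 0`) the
point value. [cite: HughesEtAl2021, (2.13)] -/
def polarAverage (f : ℝ → ℝ) : ℝ :=
  if γ.zMax = 0 then f 0
  else (4 / γ.minoPolarPeriod) * ∫ z in (0 : ℝ)..γ.zMax,
    f z * (√((1 - z ^ 2) * polarPotential a γ.energy γ.angularMomentum γ.carterConstant z))⁻¹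

/-- `Γ = ⟨T_r⟩ + ⟨T_θ⟩`, the mean rate of Boyer–Lindquist time per unit Mino time.
HWKCK 2021, (2.8). [cite: HughesEtAl2021, (2.8)] -/
def minoGamma : ℝ :=
  γ.radialAverage (minoTr M a γ.energy γ.angularMomentum) + γ.polarAverage (minoTθ a γ.energy)

/-- `Υ_r = 2π/Λ_r`. HWKCK 2021, after (2.5). [cite: HughesEtAl2021, (2.5)] -/
def upsilonR : ℝ := 2 * π / γ.minoRadialPeriod

/-- `Υ_θ = 2π/Λ_θ`. HWKCK 2021, after (2.5). [cite: HughesEtAl2021, (2.5)] -/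
def upsilonTheta : ℝ := 2 * π / γ.minoPolarPeriod

/-- `Υ_φ = ⟨Φ_r⟩ + ⟨Φ_θ⟩`. HWKCK 2021, (2.9). [cite: HughesEtAl2021, (2.9)] -/
def upsilonPhi : ℝ :=
  γ.radialAverage (minoΦr M a γ.energy γ.angularMomentum) + γ.polarAverage (minoΦθ γ.angularMomentum)

/-- The radial fundamental frequency `Ω_r = Υ_r/Γ` (coordinate time). HWKCK 2021, (2.14);
Drasco–Hughes 2006, (2.16). [cite: HughesEtAl2021, (2.14)] -/
def OmegaR : ℝ := γ.upsilonR / γ.minoGamma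

/-- The polar fundamental frequency `Ω_θ = Υ_θ/Γ`. HWKCK 2021, (2.14). [cite: HughesEtAl2021, (2.14)] -/
def OmegaTheta : ℝ := γ.upsilonTheta / γ.minoGamma

/-- The azimuthal fundamental frequency `Ω_φ = Υ_φ/Γ`. HWKCK 2021, (2.14). [cite: HughesEtAl2021, (2.14)] -/
def OmegaPhi : ℝ := γ.upsilonPhi / γ.minoGamma

/-- The discrete spectrum `ω_{mkn} = m Ω_φ + k Ω_θ + n Ω_r` of the radiation of a bound orbit.
HWKCK 2021, (3.15); Drasco–Hughes 2006, (3.29). [cite: HughesEtAl2021, (3.15)] -/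
def modeFrequency (m k n : ℤ) : ℝ := m * γ.OmegaPhi + k * γ.OmegaTheta + n * γ.OmegaR

end BoundGeodesic

end Geodesics

/-! ## Part 4. Spin-weight `-2` spheroidal eigen-data (`s = -2` angular Teukolsky equation) -/

/-- **Spin-weight `−2` spheroidal eigenpair.** `S : ℝ → ℝ` is a regular, normalised solution on
`(0, π)` of the angular Teukolsky equation with spin weight `s = −2`, oblateness `c = aω` and
azimuthal number `m`, for the separation constant `𝓔`:
`(1/sin θ)(sin θ S')' + [c² cos²θ + 4c cos θ − (m² − 4m cos θ + 4)/sin²θ + 𝓔] S = 0`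
(Hughes 2000, App. A, (A.1) with `s = −2`: `(aω)² cos²θ − 2aωs cos θ − (m² + 2ms cos θ + s²)/sin²θ
+ 𝓔`; Teukolsky 1973, (4.10)), *regular* at both poles — for this equation (Frobenius exponents
`±|m ∓ 2|/1` at `θ = 0, π`, a logarithm when they vanish) regularity is equivalent to
boundedness on `(0, π)` —, not identically zero, and normalised by
`∫_0^π S² sin θ dθ = 1/(2π)` (Drasco–Hughes 2006, (3.8), the convention under which
`⟨dE/dt⟩ = Σ |Z|²/(4πω²)`). The sign of `S` is not fixed. [cite: Hughes2000, App. A (A.1)] -/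
structure IsSpheroidalEigenpair (c : ℝ) (m : ℤ) (𝓔 : ℝ) (S : ℝ → ℝ) : Prop where
  /-- `S` is `C²` on the open interval `(0, π)`. -/
  contDiffOn : ContDiffOn ℝ 2 S (Ioo 0 π)
  /-- The `s = -2` angular Teukolsky equation on `(0, π)`. -/
  ode : ∀ θ ∈ Ioo 0 π,
    deriv (deriv S) θ + Real.cos θ / Real.sin θ * deriv S θ +
      (c ^ 2 * Real.cos θ ^ 2 + 4 * c * Real.cos θ -
          ((m : ℝ) ^ 2 - 4 * m * Real.cos θ + 4) / Real.sin θ ^ 2 + 𝓔) * S θ = 0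
  /-- Regularity at the poles: `S` is bounded on `(0, π)`. -/
  bounded : ∃ C : ℝ, ∀ θ ∈ Ioo 0 π, |S θ| ≤ C
  /-- `S` is not the zero solution. -/
  nontrivial : ∃ θ ∈ Ioo 0 π, S θ ≠ 0
  /-- Normalisation `∫_0^π S² sin θ dθ = 1/(2π)` (Drasco–Hughes 2006, (3.8)). -/
  normalised : ∫ θ in (0 : ℝ)..π, S θ ^ 2 * Real.sin θ = (2 * π)⁻¹

/-- The point spectrum `{𝓔}` of the `s = −2` angular Teukolsky problem with parameters
`(c = aω, m)` ("a discrete spectrum of eigenvalues", Drasco–Hughes 2006, after (3.6); Hughes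
2000, App. A). [cite: DrascoHughes2006, §3.1] -/
def spheroidalSpectrum (c : ℝ) (m : ℤ) : Set ℝ :=
  {𝓔 | ∃ S : ℝ → ℝ, IsSpheroidalEigenpair c m 𝓔 S}

/-- The least multipole index `ℓ_min = max(|m|, 2)` of spin weight `−2` (`l ≥ max(|m|, 2)`,
Drasco–Hughes 2006, after (3.7); Hughes 2000, App. A: `l_min = max(|s|, |m|)`). [cite: DrascoHughes2006, §3.1] -/
def minDegree (m : ℤ) : ℕ := max m.natAbs 2

/-- The **spheroidal eigenvalue `𝓔_{ℓm}(c)`**: the eigenvalue of `spheroidalSpectrum c m` having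
exactly `ℓ − ℓ_min` eigenvalues below it (the `(ℓ − ℓ_min)`-th in increasing order, so that
`𝓔_{ℓm}(0) = ℓ(ℓ+1)` continues the spin-weighted spherical harmonics; Hughes 2000, App. A),
selected by `Classical.epsilon` (junk if there is no such eigenvalue; meant for `ℓ ≥ ℓ_min`).
[cite: Hughes2000, App. A] -/
def spheroidalEigenvalue (c : ℝ) (m : ℤ) (ℓ : ℕ) : ℝ :=
  Classical.epsilon fun 𝓔 : ℝ ↦ 𝓔 ∈ spheroidalSpectrum c m ∧
    (spheroidalSpectrum c m ∩ Iio 𝓔).Finite ∧ (spheroidalSpectrum c m ∩ Iio 𝓔).ncard = ℓ - minDegree m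

/-- The **spin-weight `−2` spheroidal harmonic `S_{ℓm}(θ; c)`** (`c = aω`), `θ`-part only: a
normalised regular eigenfunction for `𝓔_{ℓm}(c)` chosen by `Classical.epsilon` (so fixed up to
sign), and the zero function for `ℓ < max(|m|, 2)`. Hughes 2000, App. A; Drasco–Hughes 2006,
(3.7)–(3.8). [cite: DrascoHughes2006, (3.7)–(3.8)] -/
def spheroidalHarmonic (c : ℝ) (m : ℤ) (ℓ : ℕ) : ℝ → ℝ :=
  if minDegree m ≤ ℓ then
    Classical.epsilon fun S : ℝ → ℝ ↦ IsSpheroidalEigenpair c m (spheroidalEigenvalue c m ℓ) S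
  else 0

/-- Below the least multipole index the spheroidal harmonic is the zero function (so that sums
over all `(ℓ, m)` only see `ℓ ≥ max(|m|, 2)`). [folklore] -/
theorem spheroidalHarmonic_of_lt {c : ℝ} {m : ℤ} {ℓ : ℕ} (h : ℓ < minDegree m) :
    spheroidalHarmonic c m ℓ = 0 := by
  simp [spheroidalHarmonic, Nat.not_le.2 h]

/-- Teukolsky's radial separation constant for `s = −2`:
`λ_{ℓm}(c) = 𝓔_{ℓm}(c) − 2mc + c² − 2` (`c = aω`; Hughes 2000, (4.4) and footnote:
`λ = 𝓔 − 2amω + a²ω² − s(s+1)`; Teukolsky 1973, (4.9)–(4.10); it enters the radial potential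
`V = −(K² + 4i(r−M)K)/Δ + 8iωr + λ` and the Starobinsky constant). [cite: Hughes2000, (4.4)] -/
def teukolskyLambda (c : ℝ) (m : ℤ) (ℓ : ℕ) : ℝ :=
  spheroidalEigenvalue c m ℓ - 2 * m * c + c ^ 2 - 2

/-! ## Part 5. The Teukolsky–Press horizon factor `α_{ℓmω}` -/

/-- The squared modulus **`|C_{ℓmω}|²` of the Teukolsky–Starobinsky constant**:
`[(λ+2)² + 4amω − 4a²ω²](λ² + 36amω − 36a²ω²) + (2λ+3)(96a²ω² − 48amω) + 144ω²(M² − a²)`.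
HWKCK 2021, (3.31); Teukolsky–Press 1974, §IV (Drasco–Hughes 2006, (3.41) and Hughes 2000,
(4.7) misprint the first `4amω` as `4aω`). [cite: HughesEtAl2021, (3.31)] -/
def starobinskyNormSq (M a w : ℝ) (m : ℤ) (lam : ℝ) : ℝ :=
  ((lam + 2) ^ 2 + 4 * a * m * w - 4 * a ^ 2 * w ^ 2) *
      (lam ^ 2 + 36 * a * m * w - 36 * a ^ 2 * w ^ 2) +
    (2 * lam + 3) * (96 * a ^ 2 * w ^ 2 - 48 * a * m * w) + 144 * w ^ 2 * (M ^ 2 - a ^ 2)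

/-- `ε = √(M² − a²)/(4Mr₊)` (half the surface gravity of the horizon). HWKCK 2021, (3.32);
Teukolsky–Press 1974, §IV. [cite: HughesEtAl2021, (3.32)] -/
def horizonEpsilon (M a : ℝ) : ℝ := √(M ^ 2 - a ^ 2) / (4 * M * rPlus M a)

/-- The **Teukolsky–Press horizon factor**
`α_{ℓmω} = 256 (2Mr₊)⁵ P (P² + 4ε²)(P² + 16ε²) ω³ / |C_{ℓmω}|²`, `P = ω − mΩ_H`,
`Ω_H = a/(2Mr₊)` (`Kerr.horizonAngularVelocity`), converting `|Z^H|²` (Kinnersley-frame `ψ₄`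
amplitude at `𝓗⁺`) into the energy flux through the horizon; its sign is that of
`ω (ω − mΩ_H)` (negative exactly on superradiant modes). HWKCK 2021, (3.30); Teukolsky–Press
1974, (4.44) and §V; Drasco–Hughes 2006, (3.40). [cite: HughesEtAl2021, (3.30)] -/
def horizonFluxFactor (M a w : ℝ) (m : ℤ) (lam : ℝ) : ℝ :=
  256 * (2 * M * rPlus M a) ^ 5 * (w - m * horizonAngularVelocity M a) *
        ((w - m * horizonAngularVelocity M a) ^ 2 + 4 * horizonEpsilon M a ^ 2) *
      ((w - m * horizonAngularVelocity M a) ^ 2 + 16 * horizonEpsilon M a ^ 2) * w ^ 3 /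
    starobinskyNormSq M a w m lam

/-- **Sign of the horizon factor.** For `M, r₊ > 0` and a positive Starobinsky constant,
`α_{ℓmω} > 0 ↔ ω(ω − mΩ_H) > 0`: the horizon energy flux of a mode is negative exactly in the
superradiant regime `0 < ω/m < Ω_H` (Teukolsky–Press 1974, §V; HWKCK 2021, after (3.30);
Drasco–Hughes 2006, §3.4). [cite: HughesEtAl2021, (3.30)] -/
theorem horizonFluxFactor_pos_iff {M a w lam : ℝ} {m : ℤ} (hM : 0 < M) (hr : 0 < rPlus M a)
    (hC : 0 < starobinskyNormSq M a w m lam) :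
    0 < horizonFluxFactor M a w m lam ↔ 0 < w * (w - m * horizonAngularVelocity M a) := by
  have hα : horizonFluxFactor M a w m lam =
      256 * (2 * M * rPlus M a) ^ 5 *
          (((w - m * horizonAngularVelocity M a) ^ 2 + 4 * horizonEpsilon M a ^ 2) *
            ((w - m * horizonAngularVelocity M a) ^ 2 + 16 * horizonEpsilon M a ^ 2)) * w ^ 2 /
          starobinskyNormSq M a w m lam * (w * (w - m * horizonAngularVelocity M a)) := by
    unfold horizonFluxFactor
    rw [div_mul_eq_mul_div]
    congr 1
    ring
  have hB : 0 ≤ 256 * (2 * M * rPlus M a) ^ 5 *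
      (((w - m * horizonAngularVelocity M a) ^ 2 + 4 * horizonEpsilon M a ^ 2) *
        ((w - m * horizonAngularVelocity M a) ^ 2 + 16 * horizonEpsilon M a ^ 2)) * w ^ 2 /
      starobinskyNormSq M a w m lam := by positivity
  rw [hα]
  refine ⟨fun h ↦ ?_, fun h ↦ ?_⟩
  · by_contra hle
    exact absurd h (not_lt.2 (mul_nonpos_of_nonneg_of_nonpos hB (not_lt.1 hle)))
  · have hw : w ≠ 0 := by
      rintro rfl
      simp at h
    have hP : w - m * horizonAngularVelocity M a ≠ 0 := by
      intro h0
      rw [h0, mul_zero] at h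
      exact lt_irrefl _ h
    have hP2 : 0 < (w - m * horizonAngularVelocity M a) ^ 2 := by positivity
    have hw2 : 0 < w ^ 2 := by positivity
    have hε : 0 ≤ horizonEpsilon M a ^ 2 := sq_nonneg _
    have h1 : 0 < (w - m * horizonAngularVelocity M a) ^ 2 + 4 * horizonEpsilon M a ^ 2 := by
      linarith
    have h2 : 0 < (w - m * horizonAngularVelocity M a) ^ 2 + 16 * horizonEpsilon M a ^ 2 := by
      linarith
    refine mul_pos (div_pos (mul_pos (mul_pos (by positivity) (mul_pos h1 h2)) hw2) hC) h

/-! ## Part 6. The point-mass perturbation, its `ψ₄`, modes, amplitudes and fluxes -/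

/-! ### `ψ₄` and the master field of a metric perturbation of Kerr -/

/-- The **perturbed Weyl scalar `ψ₄ = −δC_{αβγδ} n^α m̄^β n^γ m̄^δ`** of the metric perturbation
`h` of `g_{M,a}` (Kerr–Schild components `Kerr.bilin M a`), in the background Kinnersley tetrad
(`Kerr.kinnersleyN`, `m̄ = Re m − i Im m`, `Kerr.kinnersleyM`): with
`δR(X,Y,Z,W) = MetricCoord.linRiemannAt (Kerr.bilin M a) h x X Y Z W` (`= δ[g(R(X,Y)Z,W)]`),
`ψ₄ = −δR(n, m̄, m̄, n) = −[δR(n,u,u,n) − δR(n,v,v,n)] + i[δR(n,u,v,n) + δR(n,v,u,n)]`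
(`u = Re m`, `v = Im m`; bilinearity in the two complex slots). Off the support of the
source `δRic = 0` and `g(n,n) = g(n,m̄) = g(m̄,m̄) = 0`, so `δC(n,m̄,n,m̄) = δRiem(n,m̄,n,m̄)`; the
tetrad-variation terms vanish on the type-D background (`Ψ₃ = Ψ₄ = 0`), which is why the
background tetrad may be used (Teukolsky 1973, §II). HWKCK 2021, (3.1); Drasco–Hughes 2006,
(3.1). [cite: HughesEtAl2021, (3.1)] -/
def psi4 (M a : ℝ) (h : E4 → E4 →L[ℝ] E4 →L[ℝ] ℝ) (x : E4) : ℂ :=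
  let n := kinnersleyN M a x
  let u := kinnersleyReM a x
  let v := kinnersleyImM a x
  let δR : E4 → E4 → E4 → E4 → ℝ :=
    fun X Y Z W ↦ MetricCoord.linRiemannAt (Kerr.bilin M a) h x X Y Z W
  Complex.mk (δR n v v n - δR n u u n) (δR n u v n + δR n v u n)

/-- The **Teukolsky master field `Ψ = (r − ia cos θ)⁴ ψ₄ = ρ⁻⁴ ψ₄`** of the perturbation `h`
(the spin `s = −2` field; it is the field on which `Kerr.teukolskyOp M a (-2)` of `Sweep2.lean`
acts, and off the world-line it solves the Teukolsky equation — Teukolsky 1973, (4.7), a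
consequence, not part of this definition). HWKCK 2021, (3.2); Drasco–Hughes 2006, (3.3). [cite: HughesEtAl2021, (3.2)] -/
def masterField (M a : ℝ) (h : E4 → E4 →L[ℝ] E4 →L[ℝ] ℝ) (x : E4) : ℂ :=
  ((radius a x : ℂ) - I * (a * cosTheta a x : ℝ)) ^ 4 * psi4 M a h x

/-! ### Bohr means and the `(ω, m)` modes in Boyer–Lindquist time and azimuth -/

/-- The **Bohr mean** `M[f] = lim_{T → ∞} T⁻¹ ∫_0^T f(s) ds` of `f : ℝ → ℂ` (`limUnder`, junk
when the limit does not exist — the honest predicate is `HasBohrMean`); for an almost periodic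
`f = Σ c_j e^{-iω_j s}`, `M[e^{iωs} f] = c_ω` picks the Fourier–Bohr coefficient at `ω`. This is
how the coefficients `Z_{ℓmkn} δ(ω − ω_{mkn})` of Drasco–Hughes 2006, (3.28)–(3.29) / HWKCK
2021, (3.9), (3.14) are read off a quasi-periodic signal. [cite: DrascoHughes2006, (3.28)–(3.29)] -/
def bohrMean (f : ℝ → ℂ) : ℂ :=
  limUnder atTop fun T : ℝ ↦ (T : ℂ)⁻¹ * ∫ s in (0 : ℝ)..T, f s

/-- The Bohr mean of `f` exists. [cite: DrascoHughes2006, (3.28)–(3.29)] -/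
def HasBohrMean (f : ℝ → ℂ) : Prop :=
  ∃ c : ℂ, Tendsto (fun T : ℝ ↦ (T : ℂ)⁻¹ * ∫ s in (0 : ℝ)..T, f s) atTop (𝓝 c)

/-- If the Bohr mean exists, `bohrMean f` is it. [folklore] -/
theorem HasBohrMean.tendsto {f : ℝ → ℂ} (h : HasBohrMean f) :
    Tendsto (fun T : ℝ ↦ (T : ℂ)⁻¹ * ∫ s in (0 : ℝ)..T, f s) atTop (𝓝 (bohrMean f)) :=
  tendsto_nhds_limUnder h

/-- The **azimuthal `m`-mode** at chart time `t*`, radius `r` and polar angle `θ` of a field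
`Ψ : E4 → ℂ`: `(2π)⁻¹ ∫_0^{2π} e^{-imφ} Ψ dφ̃` over the coordinate circle
`φ̃ ↦ (t*, Y_a(r, θ, φ̃))` (`Kerr.kerrStar`), with the Boyer–Lindquist azimuth
`φ = φ̃ − φ̄(r)` (`Kerr.starAngle`; `dφ̄/dr = a/Δ`). Teukolsky 1973, (4.9) (`e^{imφ}`
dependence of the modes); Drasco–Hughes 2006, (3.9)–(3.10). [cite: DrascoHughes2006, (3.9)–(3.10)] -/
def azimuthalMode (M a : ℝ) (Ψ : E4 → ℂ) (m : ℤ) (t r θ : ℝ) : ℂ :=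
  (2 * π : ℂ)⁻¹ * ∫ φ in (0 : ℝ)..2 * π,
    exp (-(I * m * (φ - starAngle M a r : ℝ))) * Ψ (E4.ofTimeSpace t (kerrStar a r θ φ))

/-- The integrand `t* ↦ e^{iωt} × (azimuthal m-mode)` whose Bohr mean in the chart time `t*`
is the `(ω, m)` mode, with the Boyer–Lindquist time `t = t* − (r*(r) − r)` (`Kerr.blTime`) so
that the modes are those of the expansion `ψ₄ = ρ⁴ Σ R_{ℓmω}(r) S_{ℓm}(θ; aω) e^{i(mφ − ωt)}`
(HWKCK 2021, (3.4); Teukolsky 1973, (4.9)). [cite: HughesEtAl2021, (3.4)] -/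
def modeIntegrand (M a : ℝ) (Ψ : E4 → ℂ) (w : ℝ) (m : ℤ) (r θ : ℝ) (t : ℝ) : ℂ :=
  exp (I * w * (t - (tortoise M a r - r) : ℝ)) * azimuthalMode M a Ψ m t r θ

/-- The **`(ω, m)` mode** `Σ_ℓ R_{ℓmω}(r) S_{ℓm}(θ; aω)` of `Ψ` at `(r, θ)`: the Bohr mean in
time of `modeIntegrand` (for the field of a bound orbit, a quasi-periodic function of `t`, this
is the total coefficient of `e^{i(mφ − ωt)}`; it vanishes off the countable spectrum).
HWKCK 2021, (3.4) and (3.14). [cite: HughesEtAl2021, (3.4)] -/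
def mode (M a : ℝ) (Ψ : E4 → ℂ) (w : ℝ) (m : ℤ) (r θ : ℝ) : ℂ :=
  bohrMean (modeIntegrand M a Ψ w m r θ)

/-- The **radial function `R_{ℓmω}(r)`** of the `(ℓ, m, ω)` mode of `Ψ`: the projection
`2π ∫_0^π (mode) S_{ℓm}(θ; aω) sin θ dθ` of the `(ω, m)` mode on the spheroidal harmonic
(orthonormality `2π ∫ S_ℓ S_{ℓ'} sin θ dθ = δ_{ℓℓ'}` in the normalisation of Drasco–Hughes 2006,
(3.8)). HWKCK 2021, (3.4); Drasco–Hughes 2006, (3.9)–(3.10). [cite: HughesEtAl2021, (3.4)] -/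
def radialMode (M a : ℝ) (Ψ : E4 → ℂ) (ℓ : ℕ) (m : ℤ) (w r : ℝ) : ℂ :=
  2 * π * ∫ θ in (0 : ℝ)..π,
    mode M a Ψ w m r θ * (spheroidalHarmonic (a * w) m ℓ θ * Real.sin θ : ℝ)

/-- The **amplitude at infinity `Z^∞_{ℓm}(ω)`**: `R_{ℓmω}(r) → Z^∞_{ℓmω} r³ e^{iωr*}` as
`r → ∞` (HWKCK 2021, (3.5), with `C^trans` absorbed; equivalently the coefficient of
`S_{ℓm} e^{i(mφ − ωu)}/r` in `ψ₄` at `𝓘⁺`, (3.21)); `limUnder` of the ratio. For a bound orbit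
`Z^∞_{ℓm}(ω_{mkn}) = Z^∞_{ℓmkn}` (all `(k, n)` with that frequency). Drasco–Hughes 2006, (3.33)
(there called `Z^H`). [cite: HughesEtAl2021, (3.5)] -/
def ampInfinity (M a : ℝ) (Ψ : E4 → ℂ) (ℓ : ℕ) (m : ℤ) (w : ℝ) : ℂ :=
  limUnder atTop fun r : ℝ ↦
    radialMode M a Ψ ℓ m w r / ((r : ℂ) ^ 3 * exp (I * w * tortoise M a r))

/-- The **amplitude at the horizon `Z^H_{ℓm}(ω)`**:
`R_{ℓmω}(r) → Z^H_{ℓmω} Δ² e^{-i(ω − mΩ_H) r*}` as `r → r₊⁺` (HWKCK 2021, (3.6), with `B^trans`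
absorbed; Drasco–Hughes 2006, (3.10) and (3.34), there called `Z^∞`; the power `Δ²` is that of
the ingoing `s = −2` solution, Teukolsky 1973, Table 1); `limUnder` of the ratio. [cite: HughesEtAl2021, (3.6)] -/
def ampHorizon (M a : ℝ) (Ψ : E4 → ℂ) (ℓ : ℕ) (m : ℤ) (w : ℝ) : ℂ :=
  limUnder (𝓝[>] rPlus M a) fun r : ℝ ↦
    radialMode M a Ψ ℓ m w r /
      ((delta M a r : ℂ) ^ 2 * exp (-(I * (w - m * horizonAngularVelocity M a) * tortoise M a r)))

/-- The **orbit-averaged energy flux to infinity**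
`⟨dE/dt⟩^∞ = Σ_{ℓ,m} Σ_ω |Z^∞_{ℓm}(ω)|² / (4πω²)` (HWKCK 2021, (3.26); Drasco–Hughes 2006,
(3.36); Teukolsky 1973, §V / Isaacson), as a `tsum` over `(ℓ, m, ω) ∈ ℕ × ℤ × ℝ` (the family is
supported on `ℓ ≥ max(|m|,2)` and the countable frequency spectrum; the `ω = 0` term is `0`).
[cite: HughesEtAl2021, (3.26)] -/
def energyFluxInfinity (M a : ℝ) (Ψ : E4 → ℂ) : ℝ :=
  ∑' p : ℕ × ℤ × ℝ, ‖ampInfinity M a Ψ p.1 p.2.1 p.2.2‖ ^ 2 / (4 * π * p.2.2 ^ 2)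

/-- The **orbit-averaged energy flux through the horizon**
`⟨dE/dt⟩^H = Σ_{ℓ,m} Σ_ω α_{ℓmω} |Z^H_{ℓm}(ω)|² / (4πω²)` with the Teukolsky–Press factor
`Kerr.horizonFluxFactor` at `λ = λ_{ℓm}(aω)` (`Kerr.teukolskyLambda`); negative contributions
come exactly from the superradiant modes `ω(ω − mΩ_H) < 0`. HWKCK 2021, (3.26), (3.30);
Teukolsky–Press 1974, (4.44). [cite: HughesEtAl2021, (3.26)] -/
def energyFluxHorizon (M a : ℝ) (Ψ : E4 → ℂ) : ℝ :=
  ∑' p : ℕ × ℤ × ℝ,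
    horizonFluxFactor M a p.2.2 p.2.1 (teukolskyLambda (a * p.2.2) p.2.1 p.1) *
      ‖ampHorizon M a Ψ p.1 p.2.1 p.2.2‖ ^ 2 / (4 * π * p.2.2 ^ 2)

/-- The energy flux to infinity is nonnegative (each term `|Z|²/(4πω²)` is). [folklore] -/
theorem energyFluxInfinity_nonneg (M a : ℝ) (Ψ : E4 → ℂ) : 0 ≤ energyFluxInfinity M a Ψ :=
  tsum_nonneg fun _ ↦ by positivity

/-! ### Test fields, the volume density, and the hypothesis structure -/

/-- **Test fields** for the weak linearised Einstein equations on the Kerr exterior: smooth,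
compactly supported symmetric `2`-tensor fields on the chart with support inside `{r > r₊}`.
[folklore] -/
def IsTestField (M a : ℝ) (φ : E4 → E4 →L[ℝ] E4 →L[ℝ] ℝ) : Prop :=
  ContDiff ℝ ∞ φ ∧ HasCompactSupport φ ∧ tsupport φ ⊆ (exterior M a : Set E4) ∧
    ∀ (x : E4) (v w : E4), φ x v w = φ x w v

/-- The volume density `√|det g_{μν}|` of `g_{M,a}` in Kerr–Schild Cartesian coordinates
(identically `1`, since `g = Aᵀ η A` with `det A = 1` for the shear `A = Kerr.ksMap` — not used).
O'Neill 1983, Ch. 7, Def. 7.5 ff. (volume element). [cite: ONeill1983, Ch. 7] -/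
def volumeDensity (M a : ℝ) (x : E4) : ℝ :=
  √|(Matrix.of fun μ ν : Fin 4 ↦ Kerr.bilin M a x (E4.basisVector μ) (E4.basisVector ν)).det|

section Perturbation

variable [Facts] {M a : ℝ} [(metric M a (rPlus M a)).HasLeviCivita]

/-- Hypothesis structure: **the retarded first-order perturbation of `g_{M,a}` by a unit point
mass moving on the bound geodesic `γ`** — the object whose `ψ₄` Teukolsky 1973 / Teukolsky–Press
1974 / Drasco–Hughes 2006 / HWKCK 2021 expand in modes. Recorded: a symmetric field of bilinear
forms `h` on the chart which is smooth on the exterior off the world-line and locally integrable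
on the exterior; the **linearised Einstein equations with the point-mass source**
`δG[h] = 8π T`, `T^{ab}(x) = ∫ u^a u^b δ⁴(x − γ(τ)) (−g)^{-1/2} dτ` (MTW §35.13; Drasco–Hughes
2006, (3.25); Hughes 2000, (4.16)), in weak form against every test field `φ`
(`IsTestField`): `∫ ⟨h, δG[φ]⟩_g √|g| d⁴x = 8π ∫_ℝ φ_{γ(τ)}(γ̇(τ), γ̇(τ)) dτ` (the linearised
Einstein operator at a Ricci-flat metric is formally self-adjoint, being the Hessian of the
Einstein–Hilbert action); existence of the Bohr means defining the `(ω, m)` modes of the master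
field `Ψ = (r − ia cos θ)⁴ψ₄[h]` at every `(r, θ)` off the orbital shell and off the axis; and the
**retarded (no-incoming-radiation) conditions**, mode by mode for `ω ≠ 0`: at infinity
`R_{ℓmω}(r) = r³ e^{iωr*} (c₀ + c₁/r + ⋯ + c₄/r⁴) + O(r⁻²)` — a purely outgoing expansion to the
order that excludes the incoming solution `∼ r⁻¹ e^{-iωr*}` (HWKCK 2021, (3.5); Teukolsky–Press
1974, §II on the `r⁻⁴` subdominance for `s = −2`) —, and at the horizon convergence of
`R_{ℓmω}(r) / (Δ² e^{-i(ω − mΩ_H)r*})` as `r → r₊` (purely ingoing, HWKCK 2021, (3.6); this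
excludes the outgoing solution `∼ e^{+i(ω−mΩ_H)r*}`). Not recorded (theorems about this object,
see the module docstring): its existence, the uniqueness of its amplitudes (real mode
stability), the Teukolsky equation for `Ψ`, gauge conditions. [cite: HughesEtAl2021, §III.A (3.1)–(3.9)] -/
structure PointMassPerturbation (γ : BoundGeodesic M a) where
  /-- The metric perturbation, in Kerr–Schild Cartesian components (junk off the exterior). -/
  h : E4 → E4 →L[ℝ] E4 →L[ℝ] ℝ
  /-- `h` is symmetric. -/
  symm : ∀ (x : E4) (v w : E4), h x v w = h x w v
  /-- `h` is smooth on the exterior off the world-line. -/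
  smoothOff : ContDiffOn ℝ ∞ h ((exterior M a : Set E4) \ γ.worldLine)
  /-- `‖h‖` is locally integrable on the exterior (across the world-line). -/
  locallyIntegrable : LocallyIntegrableOn (fun x ↦ ‖h x‖) (exterior M a : Set E4)
  /-- The weak linearised Einstein equations with a unit point mass on `γ` as source. -/
  weak_einstein : ∀ φ : E4 → E4 →L[ℝ] E4 →L[ℝ] ℝ, IsTestField M a φ →
    ∫ x, MetricCoord.innerAt (Kerr.bilin M a) x (h x)
        (MetricCoord.linEinsteinAt (Kerr.bilin M a) φ x) * volumeDensity M a x =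
      8 * π * ∫ τ, φ (γ.pos τ) (γ.vel τ) (γ.vel τ)
  /-- The Bohr means defining the `(ω, m)` modes of `Ψ` exist off the orbital shell. -/
  hasBohrMean : ∀ (w : ℝ) (m : ℤ) (r θ : ℝ),
    (rPlus M a < r ∧ r < γ.rMin ∨ γ.rMax < r) → θ ∈ Ioo 0 π →
      HasBohrMean (modeIntegrand M a (masterField M a h) w m r θ)
  /-- Retarded at `𝓘⁺`: every radial mode is purely outgoing (five-term expansion). -/
  outgoing : ∀ (ℓ : ℕ) (m : ℤ) (w : ℝ), w ≠ 0 → ∃ c : Fin 5 → ℂ,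
    (fun r : ℝ ↦ radialMode M a (masterField M a h) ℓ m w r -
        (r : ℂ) ^ 3 * exp (I * w * tortoise M a r) * ∑ k : Fin 5, c k / (r : ℂ) ^ (k : ℕ))
      =O[atTop] fun r : ℝ ↦ (r ^ 2)⁻¹
  /-- Retarded at `𝓗⁺`: every radial mode is purely ingoing (`∼ Z^H Δ² e^{-iPr*}`). -/
  ingoing : ∀ (ℓ : ℕ) (m : ℤ) (w : ℝ), w ≠ 0 → ∃ c : ℂ,
    Tendsto (fun r : ℝ ↦ radialMode M a (masterField M a h) ℓ m w r /
        ((delta M a r : ℂ) ^ 2 *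
          exp (-(I * (w - m * horizonAngularVelocity M a) * tortoise M a r))))
      (𝓝[>] rPlus M a) (𝓝 c)

namespace PointMassPerturbation

variable {γ : BoundGeodesic M a} (𝔭 : PointMassPerturbation γ)

/-- The master field `Ψ = (r − ia cos θ)⁴ ψ₄` of the perturbation. [cite: HughesEtAl2021, (3.2)] -/
def master : E4 → ℂ := masterField M a 𝔭.h

/-- `Z^∞_{ℓm}(ω)` of the perturbation (HWKCK 2021, (3.5)). [cite: HughesEtAl2021, (3.5)] -/
def ampInf (ℓ : ℕ) (m : ℤ) (w : ℝ) : ℂ := ampInfinity M a 𝔭.master ℓ m w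

/-- `Z^H_{ℓm}(ω)` of the perturbation (HWKCK 2021, (3.6)). [cite: HughesEtAl2021, (3.6)] -/
def ampHor (ℓ : ℕ) (m : ℤ) (w : ℝ) : ℂ := ampHorizon M a 𝔭.master ℓ m w

/-- `Z^∞_{ℓmkn} := Z^∞_{ℓm}(ω_{mkn})` on the discrete spectrum of `γ` (HWKCK 2021, (3.14)–(3.16);
equal to the printed `Z^∞_{ℓmkn}` whenever no other `(k', n')` has the same frequency).
[cite: HughesEtAl2021, (3.14)–(3.16)] -/
def ampInfMKN (ℓ : ℕ) (m k n : ℤ) : ℂ := 𝔭.ampInf ℓ m (γ.modeFrequency m k n)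

/-- `Z^H_{ℓmkn} := Z^H_{ℓm}(ω_{mkn})` (HWKCK 2021, (3.14)–(3.16)). [cite: HughesEtAl2021, (3.14)–(3.16)] -/
def ampHorMKN (ℓ : ℕ) (m k n : ℤ) : ℂ := 𝔭.ampHor ℓ m (γ.modeFrequency m k n)

/-- `⟨dE/dt⟩^∞` of the orbit (HWKCK 2021, (3.26)). [cite: HughesEtAl2021, (3.26)] -/
def energyFluxInfinity : ℝ := Kerr.energyFluxInfinity M a 𝔭.master

/-- `⟨dE/dt⟩^H` of the orbit (HWKCK 2021, (3.26)). [cite: HughesEtAl2021, (3.26)] -/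
def energyFluxHorizon : ℝ := Kerr.energyFluxHorizon M a 𝔭.master

/-- The **net orbit-averaged energy flux** `⟨Ė^∞⟩ + ⟨Ė^H⟩` carried by the radiation of a unit
point mass on `γ` (to infinity plus down the horizon); `−μ²` times it is the adiabatic
`⟨dE/dt⟩` of the orbit. "No floating" is `0 < netFlux`. HWKCK 2021, (3.26) and §III.C;
Teukolsky–Press 1974, §V. [cite: HughesEtAl2021, (3.26)] -/
def netFlux : ℝ := 𝔭.energyFluxInfinity + 𝔭.energyFluxHorizon

/-- Unfolding: `netFlux = ⟨Ė^∞⟩ + ⟨Ė^H⟩`. [folklore] -/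
theorem netFlux_def : 𝔭.netFlux = 𝔭.energyFluxInfinity + 𝔭.energyFluxHorizon := rfl

/-- The flux to infinity of the perturbation is nonnegative, so a non-positive net flux can only
come from the (superradiant part of the) horizon flux. [folklore] -/
theorem energyFluxInfinity_nonneg : 0 ≤ 𝔭.energyFluxInfinity :=
  Kerr.energyFluxInfinity_nonneg M a _

/-- `⟨Ė^H⟩ ≤ netFlux`. [folklore] -/
theorem energyFluxHorizon_le_netFlux : 𝔭.energyFluxHorizon ≤ 𝔭.netFlux :=
  le_add_of_nonneg_left 𝔭.energyFluxInfinity_nonneg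

end PointMassPerturbation

end Perturbation

end Kerr

end Literature.Geometry.Lorentzian
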